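import Summits.QuantumFields.BalabanUV.Beta.EriceRemainderEnclosureHistoryAutonomyComparisonThreeAgesReads

/-!
# EriceRemainderEnclosureHistoryAutonomyComparisonThreeAgesNear — (P3·T1b) THREE AFFINE AGES WITH OUTER RATIO AT MOST 36 (AND ANY MARKOV WEIGHT) PASS THE
# PROFILE CONDITION: `L ≥ 0` supported on `{0, k₁, k₂, k₃}`, `1 ≤ k₁ < k₂ < k₃ ≤ 36·k₁` ⟹ `Σ_{j<K} L_j ∕ P_j ≤ 2`, `P_j = Σ_{k<K} L_k·√(j∕(j+k))`; hence
# `B(u) = b + L_0·u_0 + L₁·u_{k₁} + L₂·u_{k₂} + L₃·u_{k₃}` compares at any size against every `B′ ≥ B` with a zeroth moment and an ISOTONE excess ((E58b))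

Cell `pub-balaban`, β-function sub-cell, BINDER row D4 «RemainderConst leaves for Bałaban's split» (`HOME/BINDER-OWNERS.md`; owner lineage `b2b-balaban-beta-an4`);
this file by co-owner #3 lineage `b2b-balaban-beta-d4-p3` (generation 100), answering sub-problem (P1) of co-owner #2's strategy note
`HOME/b2b-balaban-beta-d4-p2/g56/STRATEGY-E58prime.md` §5 at its target ratio `R₀ = 36` («three ages at intermediate ratios», NOT CLAIMED in (E63d)
`…ComparisonTwoAgesMarkov`).  β-FLOW TEAM duty (1), FREEZE (0) honoured (def-free; (E58b)'s `le_of_isotone_excess_affine_profile`, (E63d)'s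
`two_sqrt_prod_ge_of_ratio_le` ∕ `sqrt_ratio_ge`, (P3·T1a)'s `three_age_sum_div_le_two` and read lemmas, Mathlib's `Finset.sum_insert` ∕ `Finset.sum_pair` BY NAME;
nothing restated).  Sequel of (E63d) (any two ages, any Markov weight) and (P3·T1a) `…ComparisonThreeAgesReads` (the algebra).

HONEST FRAMING (page 1, verbatim and binding).  *"Discharging BetaPertH makes Bałaban's UV stability UNCONDITIONAL — a real constructive-QFT result; it is
NOT the continuum limit and NOT the Clay problem."*  THIS FILE DISCHARGES NOTHING OF THE KIND.  Elementary real analysis about ABSTRACT affine functionals on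
a box ]0,γ]^ℕ with displayed supports and signs — hypotheses of a census, not facts; the form, signs, ages and moments of Bałaban's (1.22) limit functional
are NOT PRINTED ([I] p. 298; GAPS G-t4-U2-1∕-2) and NOT asserted.  Row D4 class UNCHANGED (critical-path width 0; instance 0∕1; D4 DISCHARGE NO DATE).
HONEST DEPENDENCY: continuum YM on T⁴ ⇐ BetaPertH ∧ nine spine estimates (0/9 proved); BetaPertH ⇐ (D1) ∧ (D4) ∧ CAP+tail; G-an2-4 gates asym, D1 and
NE2/3/4.

THE POINT (census sense (α); the COMPARISON column, conjecture (E58′)).  (E63d) settled ANY two ages with any Markov weight; (E63e) all ages within a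
factor `7`; (E63c) towers whose consecutive ratios are all `≥ 165` (`n = 3` included).  Here: THREE ages `k₁ < k₂ < k₃` with OUTER ratio `k₃ ≤ 36k₁` (every pair
then has ratio `≤ 36`) and any Markov weight `L_0` pass (E58b)'s trajectory-free profile condition `Σ_j L_j∕P_j ≤ 2` (§1
`profileSum_le_two_of_three_ages_markov`): the `j = 0` summand reads `0`, `L_0` and the empty ages only enlarge `P_{k₁}, P_{k₂}, P_{k₃}`, and what remains
is (P3·T1a)'s cubic, whose ten coefficients are `≥ 0` by (P3·T1a)'s read relations (`r ≥ 2ρqp′`, `p′ ≥ 2ρq′r`, `pr ≥ ρq`, `p′r′ ≥ ρq′`, `qr′ ≥ 0.2293p`,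
`pq′ ≥ 0.2293r′`, `pp′ + rr′ − qq′ ≥ ½`) and (E63d)'s pair bounds (`2ss′ ≥ 0.3243`, `s ≥ 0.1643`) — each tight coefficient closing at the threshold
`qq′ ≥ (1−ρ)∕(4ρ−1) ≈ 0.1602 < 0.16215`.  §2 the END by (E58b): **three near ages with any Markov weight compare at any size**.  NOT CLAIMED: outer ratio
above `36` (the true three-age supremum of the profile sum at `k₃ = 36k₁` is the two-age value `≈ 1.8021`; the termwise certificate ends near ratio `40`,
the conjectured threshold is the two-age one `≈ 134`) unless both consecutive ratios are `≥ 165` ((E63c), `n = 3`); four or more ages;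
anything printed.

WHAT IS PROVED ([folklore]; 0 `def`, 0 sorry).  §1 **`profileSum_le_two_of_three_ages_markov`**.  §2 **`le_of_isotone_excess_three_ages_markov_near`**.
-/
noncomputable section
open Finset Set

namespace Summit.QuantumFields.BalabanUV.Beta.EriceRemainderEnclosureHistoryAutonomyComparisonThreeAgesNear

open Literature.MathematicalPhysics.QuantumFieldTheory.Balaban1983to89
open Literature.MathematicalPhysics.QuantumFieldTheory.Balaban1983to89.T4BetaStationary
open Literature.MathematicalPhysics.QuantumFieldTheory.Balaban1983to89.T4BetaFlowWellPosed
open Summit.QuantumFields.BalabanUV.Beta.EriceRemainderEnclosureHistoryAutonomyComparisonAffineProfile (le_of_isotone_excess_affine_profile)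
open Summit.QuantumFields.BalabanUV.Beta.EriceRemainderEnclosureHistoryAutonomyComparisonTwoAgesMarkov (two_sqrt_prod_ge_of_ratio_le sqrt_ratio_ge)
open Summit.QuantumFields.BalabanUV.Beta.EriceRemainderEnclosureHistoryAutonomyComparisonThreeAgesReads

variable {B' : (ℕ → ℝ) → ℝ} {M' γ b : ℝ} {L : ℕ → ℝ} {K k₁ k₂ k₃ : ℕ} {h h' : ℕ → ℝ}

/-! ## §1 Three ages with outer ratio at most 36 and a Markov rider pass the profile condition -/

set_option maxHeartbeats 400000 in
/-- **THREE AGES WITH OUTER RATIO AT MOST 36 AND ANY MARKOV WEIGHT PASS THE PROFILE CONDITION**: `L ≥ 0` supported on `{0, k₁, k₂, k₃}`,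
`1 ≤ k₁ < k₂ < k₃ < K`, `k₃ ≤ 36k₁` ⟹ `Σ_{j<K} L_j ∕ P_j ≤ 2`, `P_j = Σ_{k<K} L_k·√(j∕(j+k))` — the `j = 0` summand reads `0`, the Markov weight and the
empty ages only enlarge `P_{k₁}`, `P_{k₂}`, `P_{k₃}`, and (P3·T1a)'s cleared three-age cubic has its ten coefficients `≥ 0` by (P3·T1a)'s reads and (E63d)'s
`two_sqrt_prod_ge_of_ratio_le` (`2ss′ ≥ 0.3243`) ∕ `sqrt_ratio_ge` (`s ≥ 0.1643`) for the three pairs. [folklore] -/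
theorem profileSum_le_two_of_three_ages_markov (hL : ∀ k, 0 ≤ L k) (hk₁ : 1 ≤ k₁) (h12 : k₁ < k₂) (h23 : k₂ < k₃) (h31 : k₃ ≤ 36 * k₁)
    (hk₁K : k₁ ∈ range K) (hk₂K : k₂ ∈ range K) (hk₃K : k₃ ∈ range K)
    (hsupp : ∀ k ∈ range K, k ≠ 0 → k ≠ k₁ → k ≠ k₂ → k ≠ k₃ → L k = 0) :
    ∑ j ∈ range K, L j / ∑ k ∈ range K, L k * Real.sqrt ((j : ℝ) / ((j : ℝ) + k)) ≤ 2 := by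
  have hk₂ : 1 ≤ k₂ := by omega
  have hk₃ : 1 ≤ k₃ := by omega
  have hne12 : k₁ ≠ k₂ := by omega
  have hne13 : k₁ ≠ k₃ := by omega
  have hne23 : k₂ ≠ k₃ := by omega
  set P : ℕ → ℝ := fun j => ∑ k ∈ range K, L k * Real.sqrt ((j : ℝ) / ((j : ℝ) + k)) with hP_def
  -- the outer sum lives on {k₁, k₂, k₃}
  have htri : ({k₁, k₂, k₃} : Finset ℕ) ⊆ range K := by
    intro j hj; simp only [Finset.mem_insert, Finset.mem_singleton] at hj; rcases hj with rfl | rfl | rfl <;> assumption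
  have hout : ∑ j ∈ range K, L j / P j = L k₁ / P k₁ + L k₂ / P k₂ + L k₃ / P k₃ := by
    have h3 : ∑ j ∈ ({k₁, k₂, k₃} : Finset ℕ), L j / P j = L k₁ / P k₁ + (L k₂ / P k₂ + L k₃ / P k₃) := by
      rw [sum_insert (by simp [hne12, hne13]), sum_pair hne23]
    rw [← add_assoc] at h3
    rw [← h3]
    refine (sum_subset htri fun j hj hjA => ?_).symm
    simp only [Finset.mem_insert, Finset.mem_singleton, not_or] at hjA
    rcases Nat.eq_zero_or_pos j with rfl | hjpos
    · have : P 0 = 0 := by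
        simp only [hP_def]; exact sum_eq_zero fun k _ => by rw [Nat.cast_zero, zero_div, Real.sqrt_zero, mul_zero]
      rw [this, div_zero]
    · rw [hsupp j hj (Nat.pos_iff_ne_zero.mp hjpos) hjA.1 hjA.2.1 hjA.2.2, zero_div]
  -- every P_j dominates its part on {k₁, k₂, k₃}
  have hPge : ∀ j : ℕ, L k₁ * Real.sqrt ((j : ℝ) / ((j : ℝ) + k₁)) + L k₂ * Real.sqrt ((j : ℝ) / ((j : ℝ) + k₂))
      + L k₃ * Real.sqrt ((j : ℝ) / ((j : ℝ) + k₃)) ≤ P j := by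
    intro j
    have h3 : ∑ k ∈ ({k₁, k₂, k₃} : Finset ℕ), L k * Real.sqrt ((j : ℝ) / ((j : ℝ) + k))
        = L k₁ * Real.sqrt ((j : ℝ) / ((j : ℝ) + k₁)) + (L k₂ * Real.sqrt ((j : ℝ) / ((j : ℝ) + k₂))
          + L k₃ * Real.sqrt ((j : ℝ) / ((j : ℝ) + k₃))) := by
      rw [sum_insert (by simp [hne12, hne13]), sum_pair hne23]
    rw [← add_assoc] at h3
    rw [← h3]
    exact sum_le_sum_of_subset_of_nonneg htri fun k _ _ => mul_nonneg (hL k) (Real.sqrt_nonneg _)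
  have hdiag : ∀ {m : ℕ}, 1 ≤ m → Real.sqrt ((m : ℝ) / ((m : ℝ) + m)) = Real.sqrt (1 / 2) := by
    intro m hm
    have hmr : (0 : ℝ) < m := by exact_mod_cast hm
    rw [show (m : ℝ) / ((m : ℝ) + m) = 1 / 2 by field_simp; ring]
  -- names
  set ρ : ℝ := Real.sqrt (1 / 2) with hρ_def
  set p : ℝ := Real.sqrt ((k₁ : ℝ) / ((k₁ : ℝ) + k₂)) with hp_def
  set p' : ℝ := Real.sqrt ((k₂ : ℝ) / ((k₂ : ℝ) + k₁)) with hp'_def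
  set q : ℝ := Real.sqrt ((k₁ : ℝ) / ((k₁ : ℝ) + k₃)) with hq_def
  set q' : ℝ := Real.sqrt ((k₃ : ℝ) / ((k₃ : ℝ) + k₁)) with hq'_def
  set r : ℝ := Real.sqrt ((k₂ : ℝ) / ((k₂ : ℝ) + k₃)) with hr_def
  set r' : ℝ := Real.sqrt ((k₃ : ℝ) / ((k₃ : ℝ) + k₂)) with hr'_def
  set x : ℝ := L k₁ with hx_def
  set y : ℝ := L k₂ with hy_def
  set z : ℝ := L k₃ with hz_def
  have hx : 0 ≤ x := hL k₁
  have hy : 0 ≤ y := hL k₂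
  have hz : 0 ≤ z := hL k₃
  have hDa : ρ * x + p * y + q * z ≤ P k₁ := by have := hPge k₁; rw [hdiag hk₁] at this; linarith
  have hDb : p' * x + ρ * y + r * z ≤ P k₂ := by have := hPge k₂; rw [hdiag hk₂] at this; linarith
  have hDc : q' * x + r' * y + ρ * z ≤ P k₃ := by have := hPge k₃; rw [hdiag hk₃] at this; linarith
  -- the reads: signs and bounds
  have hρ0 : 0 < ρ := Real.sqrt_pos.mpr (by norm_num)
  obtain ⟨hρsq, h2ρ_lo, h2ρ_hi⟩ := sqrt_half_bounds
  have hκ : 0 ≤ 2 * ρ - 1 := by linarith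
  have hp0 : 0 ≤ p := Real.sqrt_nonneg _
  have hp'0 : 0 ≤ p' := Real.sqrt_nonneg _
  have hq0 : 0 ≤ q := Real.sqrt_nonneg _
  have hq'0 : 0 ≤ q' := Real.sqrt_nonneg _
  have hr0 : 0 ≤ r := Real.sqrt_nonneg _
  have hr'0 : 0 ≤ r' := Real.sqrt_nonneg _
  have hplo : 0.1643 ≤ p := sqrt_ratio_ge hk₁ (by omega)
  have hqlo : 0.1643 ≤ q := sqrt_ratio_ge hk₁ h31
  have hrlo : 0.1643 ≤ r := sqrt_ratio_ge hk₂ (by omega)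
  have hp'ρ : ρ ≤ p' := diag_le_read_of_le hk₂ h12.le
  have hr'ρ : ρ ≤ r' := diag_le_read_of_le hk₃ h23.le
  have hq'ρ : ρ ≤ q' := diag_le_read_of_le hk₃ (by omega)
  have hq'1 : q' ≤ 1 := Real.sqrt_le_one.mpr (div_le_one_of_le₀ (by linarith [(Nat.cast_nonneg k₁ : (0 : ℝ) ≤ k₁)]) (by positivity))
  have hPP : 0.3243 ≤ 2 * (p * p') := two_sqrt_prod_ge_of_ratio_le hk₁ hk₂ (by omega) (by omega)
  have hQQ : 0.3243 ≤ 2 * (q * q') := two_sqrt_prod_ge_of_ratio_le hk₁ hk₃ h31 (by omega)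
  have hRR : 0.3243 ≤ 2 * (r * r') := two_sqrt_prod_ge_of_ratio_le hk₂ hk₃ (by omega) (by omega)
  have hR1 : 2 * ρ * q * p' ≤ r := read23_ge hk₁ h12.le (by omega)
  have hR2 : 2 * ρ * q' * r ≤ p' := read21_ge hk₁ (by omega) h23.le
  have hR3 : ρ * q ≤ p * r := read12_mul_read23_ge hk₁ h12.le h23.le
  have hR4 : ρ * q' ≤ p' * r' := read21_mul_read32_ge hk₁ h12.le h23.le
  have hR5 : 0.2293 * p ≤ q * r' := read13_mul_read32_ge hk₁ h12.le h23.le h31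
  have hR6 : 0.2293 * r' ≤ p * q' := read12_mul_read31_ge hk₁ h12.le h23.le h31
  have hF : 1 / 2 ≤ p * p' + r * r' - q * q' := pairSum_ge_half hk₁ h12.le h23.le h31
  -- the ten coefficients of the cubic
  have c1 : 0 ≤ (2 * ρ - 1) * p' * q' := mul_nonneg (mul_nonneg hκ hp'0) hq'0
  have c2 : 0 ≤ (2 * ρ - 1) * p * r' := mul_nonneg (mul_nonneg hκ hp0) hr'0
  have c3 : 0 ≤ (2 * ρ - 1) * q * r := mul_nonneg (mul_nonneg hκ hq0) hr0
  have c4 : 0 ≤ (2 * ρ - 1) * p' * r' + q' * (2 * p * p' - (2 * ρ - 1)) := by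
    have t1 : ρ * ρ ≤ p' * r' := mul_le_mul hp'ρ hr'ρ hρ0.le hp'0
    have t2 : (2 * ρ - 1) * (ρ * ρ) ≤ (2 * ρ - 1) * (p' * r') := mul_le_mul_of_nonneg_left t1 hκ
    have t3 : 0.3243 * q' ≤ 2 * (p * p') * q' := mul_le_mul_of_nonneg_right hPP hq'0
    have t4 : (2 * ρ - 1.3243) * q' ≤ (2 * ρ - 1.3243) * 1 := mul_le_mul_of_nonneg_left hq'1 (by linarith)
    rw [hρsq] at t2
    linarith [t2, t3, t4]
  have c5 : 0 ≤ (2 * ρ - 1) * r * q' + p' * (2 * q * q' - (2 * ρ - 1)) := by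
    have t1 : (2 * ρ - 1) * q' * (2 * ρ * q * p') ≤ (2 * ρ - 1) * q' * r := mul_le_mul_of_nonneg_left hR1 (mul_nonneg hκ hq'0)
    have t2 : 0.3243 * ((4 - 2 * ρ) * p') ≤ 2 * (q * q') * ((4 - 2 * ρ) * p') :=
      mul_le_mul_of_nonneg_right hQQ (mul_nonneg (by linarith) hp'0)
    have t3 : ρ * p' ≤ 0.70715 * p' := mul_le_mul_of_nonneg_right (by linarith) hp'0
    have t4 : ρ * ρ * (q * q' * p') = 1 / 2 * (q * q' * p') := by rw [hρsq]
    linarith [t1, t2, t3, t4]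
  have c6 : 0 ≤ (2 * ρ - 1) * p * q' + r' * (2 * p * p' - (2 * ρ - 1)) := by
    have t1 : (2 * ρ - 1) * (0.2293 * r') ≤ (2 * ρ - 1) * (p * q') := mul_le_mul_of_nonneg_left hR6 hκ
    have t2 : 0.3243 * r' ≤ 2 * (p * p') * r' := mul_le_mul_of_nonneg_right hPP hr'0
    have t3 : ρ * r' ≤ 0.70715 * r' := mul_le_mul_of_nonneg_right (by linarith) hr'0
    linarith [t1, t2, t3]
  have c7 : 0 ≤ (2 * ρ - 1) * q * p' + r * (2 * q * q' - (2 * ρ - 1)) := by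
    have t1 : (2 * ρ - 1) * q * (2 * ρ * q' * r) ≤ (2 * ρ - 1) * q * p' := mul_le_mul_of_nonneg_left hR2 (mul_nonneg hκ hq0)
    have t2 : 0.3243 * ((4 - 2 * ρ) * r) ≤ 2 * (q * q') * ((4 - 2 * ρ) * r) :=
      mul_le_mul_of_nonneg_right hQQ (mul_nonneg (by linarith) hr0)
    have t3 : ρ * r ≤ 0.70715 * r := mul_le_mul_of_nonneg_right (by linarith) hr0
    have t4 : ρ * ρ * (q * q' * r) = 1 / 2 * (q * q' * r) := by rw [hρsq]
    linarith [t1, t2, t3, t4]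
  have c8 : 0 ≤ (2 * ρ - 1) * q * r' + p * (2 * r * r' - (2 * ρ - 1)) := by
    have t1 : (2 * ρ - 1) * (0.2293 * p) ≤ (2 * ρ - 1) * (q * r') := mul_le_mul_of_nonneg_left hR5 hκ
    have t2 : 0.3243 * p ≤ 2 * (r * r') * p := mul_le_mul_of_nonneg_right hRR hp0
    have t3 : ρ * p ≤ 0.70715 * p := mul_le_mul_of_nonneg_right (by linarith) hp0
    linarith [t1, t2, t3]
  have c9 : 0 ≤ (2 * ρ - 1) * p * r + q * (2 * r * r' - (2 * ρ - 1)) := by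
    have t1 : (2 * ρ - 1) * (ρ * q) ≤ (2 * ρ - 1) * (p * r) := mul_le_mul_of_nonneg_left hR3 hκ
    have t2 : 0.3243 * q ≤ 2 * (r * r') * q := mul_le_mul_of_nonneg_right hRR hq0
    have t3 : ρ * q ≤ 0.70715 * q := mul_le_mul_of_nonneg_right (by linarith) hq0
    have t4 : ρ * ρ * q = 1 / 2 * q := by rw [hρsq]
    linarith [t1, t2, t3, t4]
  have c10 : 0 ≤ (2 * ρ - 1) * (1 / 2 + p * p' + q * q' + r * r') + 2 * (p * r * q' + q * p' * r') - 1 := by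
    have t1 : ρ * q * q' ≤ p * r * q' := mul_le_mul_of_nonneg_right hR3 hq'0
    have t1' : q * (ρ * q') ≤ q * (p' * r') := mul_le_mul_of_nonneg_left hR4 hq0
    have t5 : (2 * ρ - 1) * (1 / 2) ≤ (2 * ρ - 1) * (p * p' + r * r' - q * q') := mul_le_mul_of_nonneg_left hF hκ
    have t2 : 0.3243 * (4 * ρ - 1) ≤ 2 * (q * q') * (4 * ρ - 1) := mul_le_mul_of_nonneg_right hQQ (by linarith)
    linarith [t1, t1', t5, t2]
  rw [hout]
  -- all three weights zero: nothing to prove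
  by_cases h0 : x = 0 ∧ y = 0 ∧ z = 0
  · obtain ⟨h0x, h0y, h0z⟩ := h0
    rw [h0x, h0y, h0z]; norm_num
  have hpos : 0 < x + y + z := by
    rcases (add_nonneg (add_nonneg hx hy) hz).eq_or_lt with hsum | hsum
    · exact absurd ⟨by linarith, by linarith, by linarith⟩ h0
    · exact hsum
  -- otherwise the three rider-free denominators are positive
  have hm : (0 : ℝ) < 0.1643 := by norm_num
  have hDapos : 0 < ρ * x + p * y + q * z := pos_of_coeff_ge hm (by linarith) hplo hqlo hx hy hz hpos
  have hDbpos : 0 < p' * x + ρ * y + r * z := pos_of_coeff_ge hm (by linarith) (by linarith) hrlo hx hy hz hpos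
  have hDcpos : 0 < q' * x + r' * y + ρ * z := pos_of_coeff_ge hm (by linarith) (by linarith) (by linarith) hx hy hz hpos
  have hmain : x / (ρ * x + p * y + q * z) + y / (p' * x + ρ * y + r * z) + z / (q' * x + r' * y + ρ * z) ≤ 2 :=
    three_age_sum_div_le_two hρsq hx hy hz c1 c2 c3 c4 c5 c6 c7 c8 c9 c10 hDapos hDbpos hDcpos
  calc x / P k₁ + y / P k₂ + z / P k₃
      ≤ x / (ρ * x + p * y + q * z) + y / (p' * x + ρ * y + r * z) + z / (q' * x + r' * y + ρ * z) :=
        add_le_add (add_le_add (div_le_div_of_nonneg_left hx hDapos hDa) (div_le_div_of_nonneg_left hy hDbpos hDb))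
          (div_le_div_of_nonneg_left hz hDcpos hDc)
    _ ≤ 2 := hmain

/-! ## §2 END: three near ages with a Markov rider compare at any size -/

/-- **THREE NEAR AGES WITH ANY MARKOV WEIGHT COMPARE AT ANY SIZE.**  `B(u) = b + L_0·u_0 + L₁·u_{k₁} + L₂·u_{k₂} + L₃·u_{k₃}` on ]0,γ] (`b > 0`; `L ≥ 0`
supported on `{0, k₁, k₂, k₃}` with `1 ≤ k₁ < k₂ < k₃ < K`, `k₃ ≤ 36·k₁` — the sizes `L_0, L_{k₁}, L_{k₂}, L_{k₃}` ARBITRARY); `B′` with zeroth moment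
`M′ ≥ 0`, `B ≤ B′` on the box, the EXCESS `B′ − B` ISOTONE; `h`, `h′` ANY box solutions of `B`, `B′` from one pin `p ∈ ]0,γ]`.  Then `h′ ≤ h` at EVERY scale
((E58b) `le_of_isotone_excess_affine_profile` under §1's profile condition). [folklore] -/
theorem le_of_isotone_excess_three_ages_markov_near {p : ℝ} (hL : ∀ k, 0 ≤ L k) (hb : 0 < b) (hk₁ : 1 ≤ k₁) (h12 : k₁ < k₂) (h23 : k₂ < k₃)
    (hk₃K : k₃ < K) (h31 : k₃ ≤ 36 * k₁) (hsupp : ∀ k ∈ range K, k ≠ 0 → k ≠ k₁ → k ≠ k₂ → k ≠ k₃ → L k = 0)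
    (hB' : ∀ u u' : ℕ → ℝ, SeqBox γ u → SeqBox γ u' → ∀ D : ℝ, (∀ j, |u j - u' j| ≤ D) → |B' u - B' u'| ≤ M' * D) (hM' : 0 ≤ M')
    (hexc : ∀ u, SeqBox γ u → (fun u : ℕ → ℝ => b + ∑ k ∈ range K, L k * u k) u ≤ B' u)
    (hDmono : ∀ u v : ℕ → ℝ, SeqBox γ u → SeqBox γ v → (∀ j, u j ≤ v j) →
      B' u - (fun u : ℕ → ℝ => b + ∑ k ∈ range K, L k * u k) u ≤ B' v - (fun u : ℕ → ℝ => b + ∑ k ∈ range K, L k * u k) v)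
    (hp : 0 < p) (hpγ : p ≤ γ) (hh : SeqBox γ h) (hf : MemFlow (fun u : ℕ → ℝ => b + ∑ k ∈ range K, L k * u k) p h)
    (hh' : SeqBox γ h') (hf' : MemFlow B' p h') (j : ℕ) : h' j ≤ h j :=
  le_of_isotone_excess_affine_profile hL hb
    (profileSum_le_two_of_three_ages_markov hL hk₁ h12 h23 h31 (mem_range.mpr (by omega)) (mem_range.mpr (by omega))
      (mem_range.mpr hk₃K) hsupp)
    hB' hM' hexc hDmono hp hpγ hh hf hh' hf' j

end Summit.QuantumFields.BalabanUV.Beta.EriceRemainderEnclosureHistoryAutonomyComparisonThreeAgesNear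

end
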